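import Literature.AnabelianGeometry.EtaleTheta.Discharge.Sec1OncePuncturedCommutatorPairing
import Mathlib.Topology.Homeomorph.Lemmas
import HarnessLib

/-!
# [EtTh] §1 p. 12 «`(Ẑ(1) ≅) Δ_Θ`»: the FACT-LIST reduction `DeltaThetaIsoTate ⟸ DeltaYEllClosureIsoTate`
# (F-0658 ⟸ F-1697) — the Tate twist of `Δ_Θ` DERIVED from the Tate twist of the closure of `(Δ^tp_Y)^ell`
# through the commutator pairing `n ↦ [ι σ, n]` (proof-only, L3 interface `OncePuncturedTemperedGroup`)

Mochizuki, *The étale theta function and its Frobenioid-theoretic manifestations*, Publ. RIMS **45** (2009)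
[EtTh], §1, PRIMS PDF p. 12 (printed 238): "Then we have a natural exact sequence `1 → Ẑ(1) → Δ^ell_X → Ẑ → 1`
… Since `Δ_X` is a profinite free group on 2 generators, we also have a natural exact sequence
`1 → ∧² Δ^ell_X (≅ Ẑ(1)) → Δ^Θ_X → Δ^ell_X → 1` … Let us denote the image of `∧² Δ^ell_X` in `Δ^Θ_X` by
`(Ẑ(1) ≅) Δ_Θ ⊆ Δ^Θ_X`" [cite: MochizukiEtTh2009, §1 p.12]; the pairing is [IUTchII] Rmk. 1.1.1 (iii)
"`[-,-] : (Δ_X/Δ_Y) × Δ^ell_Y → Δ_Θ`".  abc-iut cell, block C / F = FACT-PROVING WAVE, seat abc-iut-f-172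
(gen 2), tranche 172 (F-0658 `DeltaThetaIsoTate` · F-0659 · F-1697 `DeltaYEllClosureIsoTate`, trunk
`SemiGraphs/TemperedCyclotomic.lean`, abc-iut-L3, frozen — read-only consumer, nothing edited or restated);
PROOF-ONLY (no `def`, no `instance`, no named fact).  Steps 1–2 are `Sec1OncePuncturedDtpYThetaAbelian.lean`
(`[N, N] ≤ K₃`) and `Sec1OncePuncturedCommutatorPairing.lean` (non-degeneracy, Heisenberg surjectivity).

WHAT IS PROVED, for `D : OncePuncturedTemperedGroup K` over a field `K : Type` (universe `0`, inherited from
the generic Heisenberg test groups of `DtpYEllAux`), `ι = D.toHat`, `Δ_X = D.deltaHat`, `K₂ = [Δ_X,Δ_X]⁻`,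
`K₃ = [Δ_X,[Δ_X,Δ_X]]⁻`, `N = (ι Δ^tp_Y)⁻`: the `T` of F-1697 pulls back to exactly `N ∩ Δ_X`
(`mk_mem_of_coe_mem_closureDeltaY`, `coe_mem_closureDeltaY_of_mk_mem`); `N` is normalised by `ι Π^tp_X`;
the COMMUTATOR PAIRING `ψ : Δ^ell_X → Δ^Θ_X`, `ψ(ȳ) = [ι σ, y]·K₃` (`σ ∈ Δ^tp_X ↦ 1 ∈ Z`) is a continuous
homomorphism with values in `Δ_Θ` (`exists_pairingHom`), `Π^tp_X`-EQUIVARIANT on `N` (`pairingHom_conj`: `ĝσ̂ĝ⁻¹σ̂⁻¹ ∈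
ι Δ^tp_Y` as `Z` is abelian, and `[ι Δ^tp_Y, N] ≤ K₃` by step 1); and
* `deltaThetaIsoTate_of_deltaYEllClosureIsoTate` — **F-0658 ⟸ F-1697**: for every origin binder `Ω`, if the
  closure of the image of `Δ^tp_Y` in `Δ^ell_X` is a `Π^tp_X`-stable Tate twist (`DeltaYEllClosureIsoTate Ω`),
  then `Δ_Θ` with the conjugation action of `Π^tp_X` is a Tate twist (`DeltaThetaIsoTate Ω`): `ψ|_T : T → Δ_Θ` is
  a continuous equivariant BIJECTIVE homomorphism (injective by non-degeneracy, onto by Heisenberg surjectivity,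
  step 2), a homeomorphism (compact → Hausdorff), and the level maps `ι_n ∘ (ψ|_T)⁻¹` are the Tate-twist datum.
With abc-iut-L2-t7's p432133 (F-0657 ⟸ F-1697), this seat's p436437 (F-1697 ⟸ F-0657) and L2-t7's announced
F-0659 ⟸ F-1697, the typed p. 12 cyclotomic package {F-0657, F-0658, F-0659, F-1697} hangs on ONE fact.

HONEST FRAMING: [EtTh] is refereed; the L3 interface is DATA quoting print, asserted for no curve; this file
relates two of OUR typed predicates (their universal closures over the lawless origin binder are refuted as
schemas, `TemperedCyclotomicClosures.lean`) and proves neither outright; nothing here bears on [IUTchIII]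
Cor. 3.12; typed ≠ proved; no side is taken on any disputed claim.
-/

noncomputable section

namespace Literature.AnabelianGeometry.EtaleTheta

open Literature.AnabelianGeometry.SemiGraphs
open _root_.Topology
open scoped commutatorElement
open ClassTwo

namespace OncePuncturedCyclotomic

variable {K : Type} [Field K] (D : OncePuncturedTemperedGroup K)

/-! ### Plumbing between `Δ_X/(N ∩ Δ_X)` and `Π_X/N` -/

/-- For a normal subgroup `N ≤ Π_X`, two elements of `Δ_X` agree in `Δ_X/(N ∩ Δ_X)` iff they agree in `Π_X/N`.
[cite: MochizukiEtTh2009, §1 p.12] -/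
theorem quotient_mk_eq_iff_coe (N : Subgroup D.PiHat) [N.Normal] (a b : ↥D.deltaHat) :
    (QuotientGroup.mk a : ↥D.deltaHat ⧸ N.subgroupOf D.deltaHat) = QuotientGroup.mk b ↔
      ((a : D.PiHat) : D.PiHat ⧸ N) = (b : D.PiHat) := by
  rw [QuotientGroup.eq, QuotientGroup.eq, Subgroup.mem_subgroupOf, Subgroup.coe_mul, Subgroup.coe_inv]

/-- Commutators of elements of `Δ_X` lie in `Δ_X`. [cite: MochizukiEtTh2009, §1 p.12] -/
theorem commutator_mem_deltaHat {s : D.PiHat} (hs : s ∈ D.deltaHat) (y : ↥D.deltaHat) :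
    ⁅s, (y : D.PiHat)⁆ ∈ D.deltaHat := by
  rw [commutatorElement_def]
  exact D.deltaHat.mul_mem (D.deltaHat.mul_mem (D.deltaHat.mul_mem hs y.2) (D.deltaHat.inv_mem hs))
    (D.deltaHat.inv_mem y.2)

/-! ### The subgroup `T` of F-1697 pulls back to `N = (ι Δ^tp_Y)⁻` -/

/-- If `T ≤ Δ^ell_X` is closed and its carrier is the closure of the image of `Δ^tp_Y` (the `T` of
`DeltaYEllClosureIsoTate`), then every element of `N ∩ Δ_X`, `N = (ι Δ^tp_Y)⁻ ≤ Π_X`, maps into `T`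
(the pull-back of `T` to `Π_X` is a closed subgroup containing `ι Δ^tp_Y`). [cite: MochizukiEtTh2009, §1 p.12] -/
theorem mk_mem_of_coe_mem_closureDeltaY (T : Subgroup D.DeltaEll) (hTc : IsClosed (T : Set D.DeltaEll))
    (hTset : (T : Set D.DeltaEll) = closure ((fun δ : D.delta =>
      (QuotientGroup.mk ⟨D.toHat δ, Subgroup.le_topologicalClosure _ ⟨δ, δ.2, rfl⟩⟩ : D.DeltaEll)) ''
        {δ | (δ : D.Pi) ∈ D.piY}))
    {y : ↥D.deltaHat} (hy : (y : D.PiHat) ∈ (D.deltaY.map D.toHat.toMonoidHom).topologicalClosure) :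
    (QuotientGroup.mk y : D.DeltaEll) ∈ T := by
  let S : Subgroup D.PiHat :=
    (T.comap (QuotientGroup.mk' (D.ellKerHat.subgroupOf D.deltaHat))).map D.deltaHat.subtype
  have hSc : IsClosed (S : Set D.PiHat) := by
    rw [Subgroup.coe_map, Subgroup.coe_subtype]
    refine D.isClosed_deltaHat.isClosedMap_subtype_val _ ?_
    rw [Subgroup.coe_comap]
    exact hTc.preimage QuotientGroup.continuous_mk
  have hle : D.deltaY.map D.toHat.toMonoidHom ≤ S := by
    rintro _ ⟨δ, hδ, rfl⟩
    have hδ' := Subgroup.mem_inf.mp hδ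
    refine ⟨⟨D.toHat δ, toHat_mem_deltaHat D hδ'.1⟩, ?_, rfl⟩
    rw [SetLike.mem_coe, Subgroup.mem_comap]
    have hmem : (QuotientGroup.mk ⟨D.toHat δ, toHat_mem_deltaHat D hδ'.1⟩ : D.DeltaEll) ∈
        (T : Set D.DeltaEll) := by
      rw [hTset]
      exact subset_closure ⟨⟨δ, hδ'.1⟩, hδ'.2, rfl⟩
    exact hmem
  obtain ⟨y', hy', hyy'⟩ := Subgroup.topologicalClosure_minimal _ hle hSc hy
  rw [SetLike.mem_coe, Subgroup.mem_comap] at hy'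
  have hy'y : y' = y := Subtype.ext hyy'
  rw [← hy'y]
  exact hy'

/-- Conversely, an element of `Δ_X` whose class lies in `T` belongs to `N` (the image of the closed, hence
compact, `N ∩ Δ_X` in `Δ^ell_X` is a closed subgroup containing the image of `Δ^tp_Y`, hence `T`; and
`K₂ ≤ N`). [cite: MochizukiEtTh2009, §1 p.12] -/
theorem coe_mem_closureDeltaY_of_mk_mem (T : Subgroup D.DeltaEll)
    (hTset : (T : Set D.DeltaEll) = closure ((fun δ : D.delta =>
      (QuotientGroup.mk ⟨D.toHat δ, Subgroup.le_topologicalClosure _ ⟨δ, δ.2, rfl⟩⟩ : D.DeltaEll)) ''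
        {δ | (δ : D.Pi) ∈ D.piY}))
    {y : ↥D.deltaHat} (hy : (QuotientGroup.mk y : D.DeltaEll) ∈ T) :
    (y : D.PiHat) ∈ (D.deltaY.map D.toHat.toMonoidHom).topologicalClosure := by
  haveI : CompactSpace D.PiHat := D.isProfiniteCompletion_toHat.compactSpace
  haveI : T2Space D.PiHat := D.isProfiniteCompletion_toHat.t2Space
  haveI : CompactSpace ↥D.deltaHat := isCompact_iff_compactSpace.mp D.isClosed_deltaHat.isCompact
  haveI : IsClosed ((D.ellKerHat.subgroupOf D.deltaHat : Subgroup ↥D.deltaHat) : Set ↥D.deltaHat) :=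
    (Subgroup.isClosed_topologicalClosure _).preimage continuous_subtype_val
  set N₀ : Subgroup D.PiHat := (D.deltaY.map D.toHat.toMonoidHom).topologicalClosure with hN₀def
  let N₀' : Subgroup ↥D.deltaHat := N₀.subgroupOf D.deltaHat
  have hN₀'c : IsClosed (N₀' : Set ↥D.deltaHat) :=
    (Subgroup.isClosed_topologicalClosure _).preimage continuous_subtype_val
  let M₀ : Subgroup D.DeltaEll := N₀'.map (QuotientGroup.mk' (D.ellKerHat.subgroupOf D.deltaHat))
  have hM₀c : IsClosed (M₀ : Set D.DeltaEll) := by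
    rw [Subgroup.coe_map]
    exact (hN₀'c.isCompact.image QuotientGroup.continuous_mk).isClosed
  have hTM : (T : Set D.DeltaEll) ⊆ M₀ := by
    rw [hTset]
    refine closure_minimal ?_ hM₀c
    rintro _ ⟨δ, hδ, rfl⟩
    refine ⟨⟨D.toHat δ, Subgroup.le_topologicalClosure _ ⟨δ, δ.2, rfl⟩⟩, ?_, rfl⟩
    rw [SetLike.mem_coe, Subgroup.mem_subgroupOf]
    exact Subgroup.le_topologicalClosure _ ⟨δ, Subgroup.mem_inf.mpr ⟨δ.2, hδ⟩, rfl⟩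
  obtain ⟨y', hy', hyy'⟩ := hTM hy
  have hdiff : y'⁻¹ * y ∈ D.ellKerHat.subgroupOf D.deltaHat := by
    rw [← QuotientGroup.eq]
    exact hyy'
  have hK₂N : D.ellKerHat.subgroupOf D.deltaHat ≤ N₀' := fun z hz => by
    rw [Subgroup.mem_subgroupOf] at hz ⊢
    exact ellKerHat_le_closureDeltaY D hz
  have hyN : y ∈ N₀' := by
    rw [← mul_inv_cancel_left y' y]
    exact N₀'.mul_mem hy' (hK₂N hdiff)
  exact Subgroup.mem_subgroupOf.mp hyN

/-- `N = (ι Δ^tp_Y)⁻` is normalised by `ι Π^tp_X` (`Δ^tp_Y` is normal in `Π^tp_X`, conjugation is a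
homeomorphism). [cite: MochizukiEtTh2009, §1 p.12] -/
theorem conj_toHat_mem_closureDeltaY (g : D.Pi) {n : D.PiHat}
    (hn : n ∈ (D.deltaY.map D.toHat.toMonoidHom).topologicalClosure) :
    D.toHat g * n * (D.toHat g)⁻¹ ∈ (D.deltaY.map D.toHat.toMonoidHom).topologicalClosure := by
  have hc : Continuous fun x : D.PiHat => D.toHat g * x * (D.toHat g)⁻¹ := by fun_prop
  have hsub : (fun x : D.PiHat => D.toHat g * x * (D.toHat g)⁻¹) ''
      ((D.deltaY.map D.toHat.toMonoidHom : Subgroup D.PiHat) : Set D.PiHat) ⊆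
      (((D.deltaY.map D.toHat.toMonoidHom).topologicalClosure : Subgroup D.PiHat) : Set D.PiHat) := by
    rintro _ ⟨_, ⟨y, hy, rfl⟩, rfl⟩
    have hy' := Subgroup.mem_inf.mp hy
    refine Subgroup.le_topologicalClosure _ ⟨g * y * g⁻¹, Subgroup.mem_inf.mpr
      ⟨D.delta_normal.conj_mem y hy'.1 g, D.piY_normal.conj_mem y hy'.2 g⟩, ?_⟩
    simp only [map_mul, map_inv]
    rfl
  have hn' : n ∈ closure (((D.deltaY.map D.toHat.toMonoidHom : Subgroup D.PiHat)) : Set D.PiHat) := by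
    rw [← Subgroup.topologicalClosure_coe]; exact hn
  have h1 := image_closure_subset_closure_image hc ⟨n, hn', rfl⟩
  have h2 := closure_minimal hsub (Subgroup.isClosed_topologicalClosure (D.deltaY.map D.toHat.toMonoidHom))
  exact h2 h1

/-! ### The commutator pairing `ψ : Δ^ell_X → Δ^Θ_X`, `ȳ ↦ [ι σ, y]·K₃` -/

/-- **The commutator pairing with `ι σ`** ([IUTchII] Rmk. 1.1.1 (iii) "`[-,-] : (Δ_X/Δ_Y) × Δ^ell_Y → Δ_Θ`";
[EtTh] p. 12): for `σ ∈ Δ^tp_X` there is a continuous homomorphism `ψ : Δ^ell_X → Δ^Θ_X` with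
`ψ(ȳ) = [ι σ, y]·K₃` for `y ∈ Δ_X`, taking values in `Δ_Θ = K₂/K₃` — well defined and multiplicative by the
class-two calculus (`[Δ_X, K₂] ≤ K₃`, `ClassTwo.mk_commutator_mul_right`). [cite: MochizukiEtTh2009, §1 p.12] -/
theorem exists_pairingHom {σ : D.Pi} (hσ : σ ∈ D.delta) :
    ∃ ψ : D.DeltaEll →* D.DeltaThetaX, Continuous ψ ∧ (∀ x, ψ x ∈ D.deltaTheta) ∧
      ∀ y : ↥D.deltaHat, ψ (QuotientGroup.mk y) =
        QuotientGroup.mk ⟨⁅D.toHat.toMonoidHom σ, (y : D.PiHat)⁆,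
          commutator_mem_deltaHat D (toHat_mem_deltaHat D hσ) y⟩ := by
  classical
  have hσΔ : D.toHat.toMonoidHom σ ∈ D.deltaHat := toHat_mem_deltaHat D hσ
  have hAA : ⁅D.deltaHat, D.deltaHat⁆ ≤ D.ellKerHat := Subgroup.le_topologicalClosure _
  have hAK : ⁅D.deltaHat, D.ellKerHat⁆ ≤ D.doubleCommutator :=
    ThetaQuotientFacts.commutator_deltaHat_ellKerHat_le D
  let c : ↥D.deltaHat → ↥D.deltaHat := fun y =>
    ⟨⁅D.toHat.toMonoidHom σ, (y : D.PiHat)⁆, commutator_mem_deltaHat D hσΔ y⟩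
  have hc : ∀ y, (c y : D.PiHat) = ⁅D.toHat.toMonoidHom σ, (y : D.PiHat)⁆ := fun y => rfl
  have hc_cont : Continuous c := by
    refine Continuous.subtype_mk ?_ _
    simp only [commutatorElement_def]
    fun_prop
  let ψ₀ : ↥D.deltaHat →* D.DeltaThetaX :=
    { toFun := fun y => QuotientGroup.mk (c y)
      map_one' := by
        have h1 : c 1 = 1 := Subtype.ext (by
          rw [hc, OneMemClass.coe_one, commutatorElement_one_right])
        rw [h1]
        rfl
      map_mul' := fun y y' => by
        rw [← QuotientGroup.mk_mul, quotient_mk_eq_iff_coe]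
        rw [hc, Subgroup.coe_mul, Subgroup.coe_mul, hc, hc, QuotientGroup.mk_mul]
        exact mk_commutator_mul_right D.deltaHat D.ellKerHat D.doubleCommutator hAA hAK hσΔ y.2 y'.2 }
  have hψ₀ : ∀ y, ψ₀ y = QuotientGroup.mk (c y) := fun y => rfl
  have hψ₀ker : D.ellKerHat.subgroupOf D.deltaHat ≤ ψ₀.ker := fun y hy => by
    rw [Subgroup.mem_subgroupOf] at hy
    rw [MonoidHom.mem_ker, hψ₀, ← QuotientGroup.mk_one, quotient_mk_eq_iff_coe, hc, OneMemClass.coe_one,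
      QuotientGroup.mk_one, QuotientGroup.eq_one_iff]
    exact hAK (Subgroup.commutator_mem_commutator hσΔ hy)
  let ψ : D.DeltaEll →* D.DeltaThetaX := QuotientGroup.lift _ ψ₀ hψ₀ker
  have hψmk : ∀ y : ↥D.deltaHat, ψ (QuotientGroup.mk y) = QuotientGroup.mk (c y) := fun y => rfl
  refine ⟨ψ, ?_, ?_, hψmk⟩
  · rw [(QuotientGroup.isQuotientMap_mk _).continuous_iff]
    have hcomp : (ψ ∘ QuotientGroup.mk) = fun y => QuotientGroup.mk (c y) := funext hψmk
    rw [hcomp]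
    exact QuotientGroup.continuous_mk.comp hc_cont
  · intro x
    obtain ⟨y, rfl⟩ := QuotientGroup.mk_surjective x
    rw [hψmk]
    refine ⟨c y, ?_, rfl⟩
    rw [SetLike.mem_coe, Subgroup.mem_subgroupOf, hc]
    exact hAA (Subgroup.commutator_mem_commutator hσΔ y.2)

/-- The conjugation action on `Δ^ell_X`, on classes: `g · ȳ = (ĝ y ĝ⁻¹)‾`. [cite: MochizukiEtTh2009, §1 p.12] -/
theorem conjDeltaEll_mk (g : D.Pi) (y : ↥D.deltaHat) :
    D.conjDeltaEll g (QuotientGroup.mk y) = QuotientGroup.mk (D.conjDeltaHat g y) := by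
  change QuotientGroup.map _ _ (D.conjDeltaHat g).toMonoidHom _ (QuotientGroup.mk y) = _
  rw [QuotientGroup.map_mk]
  rfl

/-- The conjugation action on `Δ^Θ_X`, on classes: `g · ȳ = (ĝ y ĝ⁻¹)‾`. [cite: MochizukiEtTh2009, §1 p.12] -/
theorem conjDeltaThetaX_mk (g : D.Pi) (y : ↥D.deltaHat) :
    D.conjDeltaThetaX g (QuotientGroup.mk y) = QuotientGroup.mk (D.conjDeltaHat g y) := by
  change QuotientGroup.map _ _ (D.conjDeltaHat g).toMonoidHom _ (QuotientGroup.mk y) = _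
  rw [QuotientGroup.map_mk]
  rfl

/-- **`Π^tp_X`-equivariance of the pairing on `N`** ([EtTh] p. 12: `Δ_Θ ≅ Ẑ(1)` "as a `G_K`-module"; the
`Z`-direction of `∧² Δ^ell_X` is Galois-trivial modulo `N`): for `g ∈ Π^tp_X` and `y ∈ N ∩ Δ_X`,
`ψ(g · ȳ) = g · ψ(ȳ)`, because `ĝ σ̂ ĝ⁻¹ = m σ̂` with `m = ι(g σ g⁻¹ σ⁻¹) ∈ ι Δ^tp_Y` (`Z` is abelian) and
`[ι Δ^tp_Y, N] ≤ K₃` (step 1). [cite: MochizukiEtTh2009, §1 p.12] -/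
theorem pairingHom_conj {σ : D.Pi} (hσ : σ ∈ D.delta) (ψ : D.DeltaEll →* D.DeltaThetaX)
    (hψ : ∀ y : ↥D.deltaHat, ψ (QuotientGroup.mk y) =
      QuotientGroup.mk ⟨⁅D.toHat.toMonoidHom σ, (y : D.PiHat)⁆,
        commutator_mem_deltaHat D (toHat_mem_deltaHat D hσ) y⟩)
    (g : D.Pi) {y : ↥D.deltaHat} (hy : (y : D.PiHat) ∈ (D.deltaY.map D.toHat.toMonoidHom).topologicalClosure) :
    ψ (D.conjDeltaEll g (QuotientGroup.mk y)) = D.conjDeltaThetaX g (ψ (QuotientGroup.mk y)) := by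
  have hσΔ : D.toHat.toMonoidHom σ ∈ D.deltaHat := toHat_mem_deltaHat D hσ
  have hAA : ⁅D.deltaHat, D.deltaHat⁆ ≤ D.ellKerHat := Subgroup.le_topologicalClosure _
  have hK₂A : D.ellKerHat ≤ D.deltaHat := D.ellKerHat_le_deltaHat
  have hAK : ⁅D.deltaHat, D.ellKerHat⁆ ≤ D.doubleCommutator :=
    ThetaQuotientFacts.commutator_deltaHat_ellKerHat_le D
  rw [conjDeltaEll_mk, hψ, hψ, conjDeltaThetaX_mk, quotient_mk_eq_iff_coe]
  have e1 : ((⟨⁅D.toHat.toMonoidHom σ, ((D.conjDeltaHat g y : ↥D.deltaHat) : D.PiHat)⁆,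
      commutator_mem_deltaHat D (toHat_mem_deltaHat D hσ) (D.conjDeltaHat g y)⟩ : ↥D.deltaHat) : D.PiHat) =
      ⁅D.toHat.toMonoidHom σ, D.toHat g * (y : D.PiHat) * (D.toHat g)⁻¹⁆ := by
    change ⁅D.toHat.toMonoidHom σ, ((D.conjDeltaHat g y : ↥D.deltaHat) : D.PiHat)⁆ = _
    rw [OncePuncturedTemperedGroup.coe_conjDeltaHat]
  have e2 : ((D.conjDeltaHat g ⟨⁅D.toHat.toMonoidHom σ, (y : D.PiHat)⁆,
      commutator_mem_deltaHat D (toHat_mem_deltaHat D hσ) y⟩ : ↥D.deltaHat) : D.PiHat) =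
      D.toHat g * ⁅D.toHat.toMonoidHom σ, (y : D.PiHat)⁆ * (D.toHat g)⁻¹ :=
    OncePuncturedTemperedGroup.coe_conjDeltaHat D g _
  rw [e1, e2]
  set gh : D.PiHat := D.toHat g with hghdef
  set sh : D.PiHat := D.toHat.toMonoidHom σ with hshdef
  set y' : D.PiHat := gh * (y : D.PiHat) * gh⁻¹ with hy'def
  set m : D.PiHat := gh * sh * gh⁻¹ * sh⁻¹ with hmdef
  -- `m = ι(g σ g⁻¹ σ⁻¹) ∈ ι Δ^tp_Y`, `y' ∈ N ∩ Δ_X`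
  have hmY : m ∈ D.deltaY.map D.toHat.toMonoidHom := by
    refine ⟨g * σ * g⁻¹ * σ⁻¹, Subgroup.mem_inf.mpr ⟨?_, ?_⟩, ?_⟩
    · exact D.delta.mul_mem (D.delta_normal.conj_mem σ hσ g) (D.delta.inv_mem hσ)
    · change g * σ * g⁻¹ * σ⁻¹ ∈ D.zQuot.ker
      rw [← commutatorElement_def]
      exact Abelianization.commutator_subset_ker D.zQuot
        (Subgroup.commutator_mem_commutator (Subgroup.mem_top g) (Subgroup.mem_top σ))
    · simp only [map_mul, map_inv, hmdef, hghdef, hshdef]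
      rfl
  have hmΔ : m ∈ D.deltaHat :=
    (Subgroup.map_mono (inf_le_left : D.deltaY ≤ D.delta)).trans (Subgroup.le_topologicalClosure _) hmY
  have hy'N : y' ∈ (D.deltaY.map D.toHat.toMonoidHom).topologicalClosure := conj_toHat_mem_closureDeltaY D g hy
  have hy'Δ : y' ∈ D.deltaHat := closureDeltaY_le_deltaHat D hy'N
  -- `ĝ [σ̂, y] ĝ⁻¹ = [ĝ σ̂ ĝ⁻¹, y'] = [m σ̂, y']`
  have hconj : gh * ⁅sh, (y : D.PiHat)⁆ * gh⁻¹ = ⁅m * sh, y'⁆ := by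
    simp only [hmdef, hy'def, commutatorElement_def]
    group
  have hm1 : ((⁅m, y'⁆ : D.PiHat) : D.PiHat ⧸ D.doubleCommutator) = 1 := by
    rw [QuotientGroup.eq_one_iff]
    exact commutator_map_deltaY_closure_le D (Subgroup.commutator_mem_commutator hmY hy'N)
  rw [hconj, mk_commutator_mul_left D.deltaHat D.ellKerHat D.doubleCommutator hAA hK₂A hAK hmΔ hσΔ hy'Δ,
    hm1, one_mul]

/-! ### F-0658 ⟸ F-1697 -/

/-- **FACT-LIST reduction F-0658 ⟸ F-1697** ([EtTh] §1 p. 12 «`1 → ∧² Δ^ell_X (≅ Ẑ(1)) → Δ^Θ_X → Δ^ell_X → 1`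
… `(Ẑ(1) ≅) Δ_Θ`»): for every origin binder `Ω` over a field `K : Type`, if the closure of the image of
`Δ^tp_Y` in `Δ^ell_X` is a closed `Π^tp_X`-stable Tate twist (`DeltaYEllClosureIsoTate Ω`, F-1697), then
`Δ_Θ ⊆ Δ^Θ_X` with the conjugation action of `Π^tp_X` is a Tate twist `Ẑ(1)` (`DeltaThetaIsoTate Ω`, F-0658).
The commutator pairing `ψ(ȳ) = [ι σ, y]·K₃` restricts to a continuous `Π^tp_X`-equivariant bijective
homomorphism `T → Δ_Θ` (injective: non-degeneracy; onto: Heisenberg surjectivity; steps 1–2), a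
homeomorphism since `T` is compact and `Δ^Θ_X` Hausdorff, and the Tate-twist level maps of `T` are
transported along its inverse. [cite: MochizukiEtTh2009, §1 p.12] -/
theorem deltaThetaIsoTate_of_deltaYEllClosureIsoTate (Ω : TemperedPiOrigin K)
    (h : OncePuncturedTemperedGroup.DeltaYEllClosureIsoTate Ω) :
    OncePuncturedTemperedGroup.DeltaThetaIsoTate Ω := by
  classical
  intro D hD
  obtain ⟨T, hT, hTc, hTate, hTset⟩ := h D hD
  haveI : CompactSpace D.PiHat := D.isProfiniteCompletion_toHat.compactSpace
  haveI : T2Space D.PiHat := D.isProfiniteCompletion_toHat.t2Space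
  haveI : CompactSpace ↥D.deltaHat := isCompact_iff_compactSpace.mp D.isClosed_deltaHat.isCompact
  haveI : IsClosed ((D.doubleCommutator.subgroupOf D.deltaHat : Subgroup ↥D.deltaHat) : Set ↥D.deltaHat) :=
    (Subgroup.isClosed_topologicalClosure _).preimage continuous_subtype_val
  haveI : CompactSpace ↥T := isCompact_iff_compactSpace.mp hTc.isCompact
  -- a generator `σ` of `Z` inside `Δ^tp_X`, and the pairing `ψ`
  obtain ⟨σ, hσ, hσZ⟩ := exists_delta_zQuot_eq_one D
  obtain ⟨ψ, hψc, hψΘ, hψmk⟩ := exists_pairingHom D hσ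
  let Φ : ↥T →* ↥D.deltaTheta := (ψ.comp T.subtype).codRestrict D.deltaTheta fun t => hψΘ _
  have hΦ : ∀ t : ↥T, (Φ t : D.DeltaThetaX) = ψ (t : D.DeltaEll) := fun t => rfl
  have hΦc : Continuous Φ := Continuous.subtype_mk (hψc.comp continuous_subtype_val) _
  -- injective (non-degeneracy)
  have hΦinj : Function.Injective Φ := by
    rw [injective_iff_map_eq_one]
    intro t ht
    obtain ⟨y, hy⟩ := QuotientGroup.mk_surjective (t : D.DeltaEll)
    have hyT : (QuotientGroup.mk y : D.DeltaEll) ∈ T := by rw [hy]; exact t.2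
    have hyN := coe_mem_closureDeltaY_of_mk_mem D T hTset hyT
    have h1 : ψ (QuotientGroup.mk y) = 1 := by
      rw [hy, ← hΦ, ht, OneMemClass.coe_one]
    rw [hψmk, ← QuotientGroup.mk_one, quotient_mk_eq_iff_coe, OneMemClass.coe_one, QuotientGroup.mk_one,
      QuotientGroup.eq_one_iff] at h1
    have hyK₂ : (y : D.PiHat) ∈ D.ellKerHat := mem_ellKerHat_of_commutator_mem_doubleCommutator D hσ hσZ hyN h1
    apply Subtype.ext
    rw [← hy, OneMemClass.coe_one, ← QuotientGroup.mk_one, QuotientGroup.eq, mul_one, Subgroup.mem_subgroupOf,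
      Subgroup.coe_inv]
    exact D.ellKerHat.inv_mem hyK₂
  -- surjective (Heisenberg surjectivity)
  have hΦsurj : Function.Surjective Φ := by
    rintro ⟨θ, hθ⟩
    obtain ⟨k, hk, rfl⟩ := hθ
    rw [SetLike.mem_coe, Subgroup.mem_subgroupOf] at hk
    obtain ⟨n, hn, k₃, hk₃, hkeq⟩ := exists_commutator_mul_of_mem_ellKerHat D hσ hσZ hk
    have hnΔ : n ∈ D.deltaHat := closureDeltaY_le_deltaHat D hn
    have hnT : (QuotientGroup.mk ⟨n, hnΔ⟩ : D.DeltaEll) ∈ T :=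
      mk_mem_of_coe_mem_closureDeltaY D T hTc hTset hn
    refine ⟨⟨QuotientGroup.mk ⟨n, hnΔ⟩, hnT⟩, Subtype.ext ?_⟩
    rw [hΦ]
    change ψ (QuotientGroup.mk ⟨n, hnΔ⟩) = QuotientGroup.mk k
    rw [hψmk, quotient_mk_eq_iff_coe, hkeq, QuotientGroup.mk_mul, (QuotientGroup.eq_one_iff k₃).mpr hk₃,
      mul_one]
  -- the equivariant isomorphism `e : T ≃* Δ_Θ` and its continuity both ways
  let e : ↥T ≃* ↥D.deltaTheta := MulEquiv.ofBijective Φ ⟨hΦinj, hΦsurj⟩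
  have he : ∀ t, e t = Φ t := fun t => rfl
  have hec : Continuous e := hΦc
  have hesymmc : Continuous e.symm :=
    (Continuous.homeoOfEquivCompactToT2 (f := e.toEquiv) hec).symm.continuous
  have hequiv : ∀ (g : D.Pi) (t : ↥T),
      e ⟨D.conjDeltaEll g t, hT g t t.2⟩ = ⟨D.conjDeltaThetaX g (e t), D.conjDeltaThetaX_mem_deltaTheta g (e t).2⟩ := by
    intro g t
    apply Subtype.ext
    change ψ (D.conjDeltaEll g (t : D.DeltaEll)) = D.conjDeltaThetaX g (ψ (t : D.DeltaEll))
    obtain ⟨y, hy⟩ := QuotientGroup.mk_surjective (t : D.DeltaEll)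
    have hyT : (QuotientGroup.mk y : D.DeltaEll) ∈ T := by rw [hy]; exact t.2
    have hyN := coe_mem_closureDeltaY_of_mk_mem D T hTset hyT
    rw [← hy]
    exact pairingHom_conj D hσ ψ hψmk g hyN
  -- transport of the Tate-twist datum
  obtain ⟨ιT, h1, h2, h3, h4, h5, h6⟩ := hTate
  unfold OncePuncturedTemperedGroup.IsTateTwist
  refine ⟨fun n => (ιT n).comp e.symm.toMonoidHom, ?_, ?_, ?_, ?_, ?_, ?_⟩
  · exact fun n hn θ => h1 n hn (e.symm θ)
  · intro n hn ζ hζ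
    obtain ⟨t, ht⟩ := h2 n hn ζ hζ
    exact ⟨e t, by change ιT n (e.symm (e t)) = ζ; rw [MulEquiv.symm_apply_apply, ht]⟩
  · intro n hn
    have hker : ((((ιT n).comp e.symm.toMonoidHom).ker : Subgroup ↥D.deltaTheta) : Set ↥D.deltaTheta) =
        e.symm ⁻¹' (((ιT n).ker : Subgroup ↥T) : Set ↥T) := by
      ext θ
      simp only [SetLike.mem_coe, MonoidHom.mem_ker, MonoidHom.coe_comp, Function.comp_apply,
        Set.mem_preimage, MulEquiv.coe_toMonoidHom]
    rw [hker]
    exact (h3 n hn).preimage hesymmc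
  · exact fun n m hn hm θ => h4 n m hn hm (e.symm θ)
  · intro θ hθ
    have h := h5 (e.symm θ) fun n hn => hθ n hn
    rw [MulEquiv.symm_apply_eq] at h; rw [h, map_one]
  · intro n hn g θ
    have key : e.symm ⟨D.conjDeltaThetaX g θ, D.conjDeltaThetaX_mem_deltaTheta g θ.2⟩ =
        ⟨D.conjDeltaEll g (e.symm θ), hT g _ (e.symm θ).2⟩ := by
      rw [MulEquiv.symm_apply_eq]
      have h7 := hequiv g (e.symm θ)
      rw [MulEquiv.apply_symm_apply] at h7
      exact h7.symm
    change ((ιT n (e.symm ⟨D.conjDeltaThetaX g θ, _⟩) : (AlgebraicClosure K)ˣ) : AlgebraicClosure K) =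
      OncePuncturedTemperedGroup.galApply (D.aug g) ((ιT n (e.symm θ) : (AlgebraicClosure K)ˣ) : AlgebraicClosure K)
    rw [key]
    exact h6 n hn g (e.symm θ)

end OncePuncturedCyclotomic

end Literature.AnabelianGeometry.EtaleTheta

end
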